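import Mathlib
import HarnessLib
import Summits.KontsevichZagierPeriods.KontsevichZagierPeriods.Theorems.LinRedNormalFormDihedralNormalFormStubNonSimpleReductionAux1

/-!
# Dihedral reflection of cubical atoms, II: the reflected exponents and the reflection identity

Sequel of `…StubNonSimpleReductionAux1` (crux `DihedralNormalForm`, stmt-KontsevichZagierPeriods-3912,
line `torus-descent-sum-shadow`, stub `stub_nonSimpleReduction`). With the reflected exponents
`a' = AF e`, `e' = eP a e` of a cubical atom (again VARIABLES constrained by the defining hypotheses
`hE0`, `hE1`, `heP`, `hAF` — no new definitions), three finite-sum identities (monomial letters,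
prefix-chord letters, strict-chord letters — the last one a reindexing by `(i, j) ↦ (τ j, τ i)`) and
their assembly into the **reflection identity**
`A a e z · ∏ yⱼ^{k-1-j} / ∏ zⱼ^{k-1-j} = A a' e' y` for the reflected point `z` (logarithmic form,
then exponentiated).
-/

noncomputable section

open Finset Real

namespace Summit.KontsevichZagierPeriods.DihedralNormalForm.TorusDescent

variable {k : ℕ}
variable (T : ℕ → (Fin k → ℝ) → ℝ) (I : Fin k → Fin k → (Fin k → ℝ) → ℝ)
  (A : (Fin k → ℕ) → (Fin k → Fin k → ℤ) → (Fin k → ℝ) → ℝ) (τ : Fin k → Fin k)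
  (E0 : (Fin k → ℕ) → (Fin k → Fin k → ℤ) → Fin k → ℤ) (E1 : (Fin k → Fin k → ℤ) → Fin k → Fin k → ℤ)
  (eP : (Fin k → ℕ) → (Fin k → Fin k → ℤ) → Fin k → Fin k → ℤ) (AF : (Fin k → Fin k → ℤ) → Fin k → ℤ)

/-! ### The reflected exponents -/

/-- `E1 e i j = e (τ j) (τ i)` for `i, j ≠ 0`. -/
theorem E1_eq (hτ1 : ∀ m : Fin k, (m : ℕ) ≠ 0 → ((τ m : Fin k) : ℕ) = k - m)
    (hE1 : ∀ (e : Fin k → Fin k → ℤ) (i j : Fin k), E1 e i j =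
      ∑ i' : Fin k, ∑ j' : Fin k, if (i' : ℕ) + (j : ℕ) = k ∧ (j' : ℕ) + (i : ℕ) = k then e i' j' else 0)
    (e : Fin k → Fin k → ℤ) {i j : Fin k} (hi : (i : ℕ) ≠ 0) (hj : (j : ℕ) ≠ 0) :
    E1 e i j = e (τ j) (τ i) := by
  rw [hE1]
  have h1 : ∀ i' : Fin k, (∑ j' : Fin k, if (i' : ℕ) + (j : ℕ) = k ∧ (j' : ℕ) + (i : ℕ) = k
      then e i' j' else 0) = if (i' : ℕ) + (j : ℕ) = k then e i' (τ i) else 0 := by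
    intro i'
    by_cases h : (i' : ℕ) + (j : ℕ) = k
    · simp_rw [if_pos h]
      have : ∀ j' : Fin k, ((i' : ℕ) + (j : ℕ) = k ∧ (j' : ℕ) + (i : ℕ) = k) ↔
          ((i : ℕ) + (j' : ℕ) = k) := fun j' => by constructor <;> intro h' <;> omega
      simp_rw [this, sum_ite_cond_τ τ hτ1 i (fun j' => e i' j'), if_neg hi]
    · rw [if_neg h]
      exact Finset.sum_eq_zero fun j' _ => if_neg fun h' => h h'.1
  simp_rw [h1]
  have : ∀ i' : Fin k, ((i' : ℕ) + (j : ℕ) = k) ↔ ((j : ℕ) + (i' : ℕ) = k) := fun i' => by omega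
  simp_rw [this, sum_ite_cond_τ τ hτ1 j (fun i' => e i' (τ i)), if_neg hj]

/-! ### The three sum identities -/

/-- (S1) Monomial letters: `Σ_{i ≤ j} e i j · log T (k-j) y = Σ_l (Σ_{i ≤ j, j+l+1 ≤ k} e i j) log y_l`. -/
theorem sumId_mono (e : Fin k → Fin k → ℤ) (Ly : Fin k → ℝ) :
    (∑ i : Fin k, ∑ j : Fin k, if i ≤ j then
        (e i j : ℝ) * (∑ l : Fin k, if (l : ℕ) < k - j then Ly l else 0) else 0) =
      ∑ l : Fin k, (∑ i : Fin k, ∑ j : Fin k,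
        if i ≤ j ∧ (j : ℕ) + (l : ℕ) + 1 ≤ k then (e i j : ℝ) else 0) * Ly l := by
  have h1 : ∀ i j : Fin k, (if i ≤ j then
      (e i j : ℝ) * (∑ l : Fin k, if (l : ℕ) < k - j then Ly l else 0) else 0) =
      ∑ l : Fin k, (if i ≤ j ∧ (j : ℕ) + (l : ℕ) + 1 ≤ k then (e i j : ℝ) else 0) * Ly l := by
    intro i j
    by_cases hij : i ≤ j
    · rw [if_pos hij, Finset.mul_sum]
      refine Finset.sum_congr rfl fun l _ => ?_
      have hj := j.isLt
      by_cases hl : (l : ℕ) < k - j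
      · rw [if_pos hl, if_pos ⟨hij, by omega⟩]
      · rw [if_neg hl, if_neg (fun h => hl (by omega)), mul_zero, zero_mul]
    · rw [if_neg hij]
      symm
      exact Finset.sum_eq_zero fun l _ => by rw [if_neg (fun h => hij h.1), zero_mul]
  simp_rw [h1]
  have h2 : ∀ l : Fin k, (∑ i : Fin k, ∑ j : Fin k,
      if i ≤ j ∧ (j : ℕ) + (l : ℕ) + 1 ≤ k then (e i j : ℝ) else 0) * Ly l =
      ∑ i : Fin k, ∑ j : Fin k, (if i ≤ j ∧ (j : ℕ) + (l : ℕ) + 1 ≤ k then (e i j : ℝ) else 0) *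
        Ly l := by
    intro l
    rw [Finset.sum_mul]
    exact Finset.sum_congr rfl fun i _ => Finset.sum_mul _ _ _
  simp_rw [h2]
  calc (∑ i : Fin k, ∑ j : Fin k, ∑ l : Fin k,
        (if i ≤ j ∧ (j : ℕ) + (l : ℕ) + 1 ≤ k then (e i j : ℝ) else 0) * Ly l)
      = ∑ i : Fin k, ∑ l : Fin k, ∑ j : Fin k,
        (if i ≤ j ∧ (j : ℕ) + (l : ℕ) + 1 ≤ k then (e i j : ℝ) else 0) * Ly l :=
          Finset.sum_congr rfl fun i _ => Finset.sum_comm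
    _ = _ := Finset.sum_comm

/-- (S2) Prefix letters. -/
theorem sumId_prefix (hτ1 : ∀ m : Fin k, (m : ℕ) ≠ 0 → ((τ m : Fin k) : ℕ) = k - m)
    (hE0 : ∀ (a : Fin k → ℕ) (e : Fin k → Fin k → ℤ) (j : Fin k), E0 a e j =
      (∑ l : Fin k, if (l : ℕ) + 1 + (j : ℕ) = k then (a l : ℤ) else 0) -
        (∑ l : Fin k, if (l : ℕ) + (j : ℕ) = k then (a l : ℤ) + 1 else 0) -
        ∑ i' : Fin k, ∑ j' : Fin k, if (i' : ℕ) + (j : ℕ) = k ∧ i' ≤ j' then e i' j' else 0)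
    (a : Fin k → ℕ) (e : Fin k → Fin k → ℤ) (Q : ℕ → ℝ) :
    (∑ i : Fin k, (a i : ℝ) * Q (k - i)) -
      (∑ i : Fin k, if (i : ℕ) = 0 then 0 else ((a i : ℝ) + 1) * Q (k + 1 - i)) -
      (∑ i : Fin k, ∑ j : Fin k, if i ≤ j ∧ (i : ℕ) ≠ 0 then (e i j : ℝ) * Q (k + 1 - i) else 0) =
      ∑ j : Fin k, (E0 a e j : ℝ) * Q ((j : ℕ) + 1) := by
  -- expand `E0` and distribute
  have hE : ∀ j : Fin k, (E0 a e j : ℝ) * Q ((j : ℕ) + 1) =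
      (∑ l : Fin k, if (l : ℕ) + 1 + (j : ℕ) = k then (a l : ℝ) * Q ((j : ℕ) + 1) else 0) -
      (∑ l : Fin k, if (l : ℕ) + (j : ℕ) = k then ((a l : ℝ) + 1) * Q ((j : ℕ) + 1) else 0) -
      ∑ i' : Fin k, ∑ j' : Fin k, if (i' : ℕ) + (j : ℕ) = k ∧ i' ≤ j'
        then (e i' j' : ℝ) * Q ((j : ℕ) + 1) else 0 := by
    intro j
    rw [hE0]
    push_cast
    simp only [sub_mul, Finset.sum_mul, ite_mul, zero_mul]
  simp_rw [hE]
  rw [Finset.sum_sub_distrib, Finset.sum_sub_distrib]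
  congr 1
  · congr 1
    · -- Σ_j Σ_l [l+1+j=k] a_l Q(j+1) = Σ_l a_l Q(k-l)
      rw [Finset.sum_comm]
      refine Finset.sum_congr rfl fun l _ => ?_
      rw [sum_ite_cond_rev l (fun j => (a l : ℝ) * Q ((j : ℕ) + 1))]
      congr 2
      rw [Fin.val_rev]; have := l.isLt; omega
    · rw [Finset.sum_comm]
      refine Finset.sum_congr rfl fun l _ => ?_
      rw [sum_ite_cond_τ τ hτ1 l (fun j => ((a l : ℝ) + 1) * Q ((j : ℕ) + 1))]
      split_ifs with hl
      · rfl
      · congr 2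
        rw [hτ1 l hl]; have := l.isLt; omega
  · -- Σ_j Σ_i' Σ_j' [i'+j=k ∧ i'≤j'] e Q(j+1) = Σ_i Σ_j [i≤j ∧ i≠0] e i j Q(k+1-i)
    symm
    rw [Finset.sum_comm]
    refine Finset.sum_congr rfl fun i _ => ?_
    rw [Finset.sum_comm]
    refine Finset.sum_congr rfl fun j _ => ?_
    have : ∀ x : Fin k, ((i : ℕ) + (x : ℕ) = k ∧ i ≤ j) ↔ (i ≤ j ∧ (i : ℕ) + (x : ℕ) = k) :=
      fun x => and_comm
    simp_rw [this, ite_and]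
    by_cases hij : i ≤ j
    · simp_rw [if_pos hij]
      rw [sum_ite_cond_τ τ hτ1 i (fun x => (e i j : ℝ) * Q ((x : ℕ) + 1))]
      by_cases hi : (i : ℕ) = 0
      · rw [if_pos hi, if_neg (show ¬((i : ℕ) ≠ 0) from fun h => h hi)]
      · rw [if_neg hi, if_pos hi]
        congr 2
        rw [hτ1 i hi]; have := i.isLt; omega
    · simp_rw [if_neg hij]
      simp

/-- (S3) Strict chord letters: reindexing by `(i, j) ↦ (τ j, τ i)`. -/
theorem sumId_strict (hτ0 : ∀ m : Fin k, (m : ℕ) = 0 → τ m = m)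
    (hτ1 : ∀ m : Fin k, (m : ℕ) ≠ 0 → ((τ m : Fin k) : ℕ) = k - m)
    (hE1 : ∀ (e : Fin k → Fin k → ℤ) (i j : Fin k), E1 e i j =
      ∑ i' : Fin k, ∑ j' : Fin k, if (i' : ℕ) + (j : ℕ) = k ∧ (j' : ℕ) + (i : ℕ) = k then e i' j' else 0)
    (e : Fin k → Fin k → ℤ) (C : Fin k → Fin k → ℝ) :
    (∑ i : Fin k, ∑ j : Fin k, if i ≤ j ∧ (i : ℕ) ≠ 0 then (e i j : ℝ) * C (τ j) (τ i) else 0) =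
      ∑ i : Fin k, ∑ j : Fin k, if i ≤ j ∧ (i : ℕ) ≠ 0 then (E1 e i j : ℝ) * C i j else 0 := by
  -- rewrite `E1` on the support
  have h1 : ∀ i j : Fin k, (if i ≤ j ∧ (i : ℕ) ≠ 0 then (E1 e i j : ℝ) * C i j else 0) =
      if i ≤ j ∧ (i : ℕ) ≠ 0 then (e (τ j) (τ i) : ℝ) * C i j else 0 := by
    intro i j
    split_ifs with h
    · have hj : (j : ℕ) ≠ 0 := by have := Fin.le_def.mp h.1; omega
      rw [E1_eq τ E1 hτ1 hE1 e h.2 hj]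
    · rfl
  simp_rw [h1]
  -- pass to sums over pairs and reindex by `Ψ`
  rw [← Fintype.sum_prod_type' (fun (i j : Fin k) => if i ≤ j ∧ (i : ℕ) ≠ 0
      then (e i j : ℝ) * C (τ j) (τ i) else 0),
    ← Fintype.sum_prod_type' (fun (i j : Fin k) => if i ≤ j ∧ (i : ℕ) ≠ 0
      then (e (τ j) (τ i) : ℝ) * C i j else 0)]
  let Ψ : Fin k × Fin k ≃ Fin k × Fin k := ⟨fun p => (τ p.2, τ p.1), fun p => (τ p.2, τ p.1),
    fun p => by simp [τ_τ τ hτ0 hτ1], fun p => by simp [τ_τ τ hτ0 hτ1]⟩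
  rw [← Equiv.sum_comp Ψ]
  refine Fintype.sum_congr _ _ fun p => ?_
  obtain ⟨i, j⟩ := p
  show (if τ j ≤ τ i ∧ ((τ j : Fin k) : ℕ) ≠ 0 then (e (τ j) (τ i) : ℝ) * C (τ (τ i)) (τ (τ j))
    else 0) = if i ≤ j ∧ (i : ℕ) ≠ 0 then (e (τ j) (τ i) : ℝ) * C i j else 0
  rw [τ_τ τ hτ0 hτ1, τ_τ τ hτ0 hτ1]
  by_cases hi : (i : ℕ) = 0
  · have hR : ¬(i ≤ j ∧ (i : ℕ) ≠ 0) := fun h => h.2 hi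
    have hL : ¬(τ j ≤ τ i ∧ ((τ j : Fin k) : ℕ) ≠ 0) := by
      rintro ⟨h1', h2'⟩
      have h3 : ((τ i : Fin k) : ℕ) = 0 := by rw [hτ0 i hi]; exact hi
      have h4 := Fin.le_def.mp h1'
      rw [h3] at h4
      exact h2' (by omega)
    rw [if_neg hL, if_neg hR]
  · by_cases hj : (j : ℕ) = 0
    · have hR : ¬(i ≤ j ∧ (i : ℕ) ≠ 0) := fun h => by have := Fin.le_def.mp h.1; omega
      have hL : ¬(τ j ≤ τ i ∧ ((τ j : Fin k) : ℕ) ≠ 0) := fun h => ((τ_ne_iff τ hτ0 hτ1 j).mp h.2) hj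
      rw [if_neg hL, if_neg hR]
    · have hiff : (τ j ≤ τ i ∧ ((τ j : Fin k) : ℕ) ≠ 0) ↔ (i ≤ j ∧ (i : ℕ) ≠ 0) := by
        rw [τ_le_τ_iff τ hτ1 hi hj, τ_ne_iff τ hτ0 hτ1]
        exact ⟨fun h => ⟨h.1, hi⟩, fun h => ⟨h.1, hj⟩⟩
      rw [if_congr hiff rfl rfl]


/-! ### Assembly: the reflection identity -/

/-- A sum over `Fin k` of a term supported at the index of value `0`. -/
theorem sum_ite_val_zero {M : Type*} [AddCommMonoid M] (hk : 0 < k) (g : M) :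
    (∑ i : Fin k, if (i : ℕ) = 0 then g else 0) = g := by
  have : ∀ i : Fin k, ((i : ℕ) = 0) ↔ (i = ⟨0, hk⟩) := fun i => by rw [Fin.ext_iff]
  simp_rw [this]
  rw [Finset.sum_ite_eq']; simp

/-- **The reflection identity** (algebraic core of the dihedral reflection of cubical atoms). If
`z` has partial products `T m z = 1 - T (k+1-m) y` (`1 ≤ m ≤ k`) — i.e. `z = C⁻¹(𝟙 - (C y)^{rev})`
for the cubical chart `C` — then
`A a e z · (∏ yⱼ^{k-1-j}) / (∏ zⱼ^{k-1-j}) = A a' e' y` with the reflected exponents `a' = AF e`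
(given as naturals) and `e' = eP a e`. -/
theorem reflection_identity (hT : ∀ (m : ℕ) (x : Fin k → ℝ), T m x = ∏ j : Fin k, if (j : ℕ) < m then x j else 1)
    (hI : ∀ (i j : Fin k) (x : Fin k → ℝ), I i j x = ∏ l : Fin k, if i ≤ l ∧ l ≤ j then x l else 1)
    (hA : ∀ (a : Fin k → ℕ) (e : Fin k → Fin k → ℤ) (x : Fin k → ℝ), A a e x =
      (∏ i : Fin k, x i ^ a i) * ∏ i : Fin k, ∏ j : Fin k, if i ≤ j then (1 - I i j x) ^ e i j else 1)
    (hτ0 : ∀ m : Fin k, (m : ℕ) = 0 → τ m = m) (hτ1 : ∀ m : Fin k, (m : ℕ) ≠ 0 → ((τ m : Fin k) : ℕ) = k - m)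
    (hE0 : ∀ (a : Fin k → ℕ) (e : Fin k → Fin k → ℤ) (j : Fin k), E0 a e j =
      (∑ l : Fin k, if (l : ℕ) + 1 + (j : ℕ) = k then (a l : ℤ) else 0) -
        (∑ l : Fin k, if (l : ℕ) + (j : ℕ) = k then (a l : ℤ) + 1 else 0) -
        ∑ i' : Fin k, ∑ j' : Fin k, if (i' : ℕ) + (j : ℕ) = k ∧ i' ≤ j' then e i' j' else 0)
    (hE1 : ∀ (e : Fin k → Fin k → ℤ) (i j : Fin k), E1 e i j =
      ∑ i' : Fin k, ∑ j' : Fin k, if (i' : ℕ) + (j : ℕ) = k ∧ (j' : ℕ) + (i : ℕ) = k then e i' j' else 0)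
    (heP : ∀ (a : Fin k → ℕ) (e : Fin k → Fin k → ℤ) (i j : Fin k), eP a e i j =
      if (i : ℕ) = 0 then E0 a e j else E1 e i j)
    (hAF : ∀ (e : Fin k → Fin k → ℤ) (l : Fin k), AF e l =
      ((k : ℤ) - 1 - (l : ℕ)) + ∑ i' : Fin k, ∑ j' : Fin k,
        if i' ≤ j' ∧ (j' : ℕ) + (l : ℕ) + 1 ≤ k then e i' j' else 0)
    {y z : Fin k → ℝ} (hy : ∀ i, y i ∈ Set.Ioo (0 : ℝ) 1) (hz : ∀ i, z i ∈ Set.Ioo (0 : ℝ) 1)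
    (hTz : ∀ m : ℕ, 1 ≤ m → m ≤ k → T m z = 1 - T (k + 1 - m) y)
    (a : Fin k → ℕ) (e : Fin k → Fin k → ℤ) (a' : Fin k → ℕ) (ha' : ∀ l, (a' l : ℤ) = AF e l) :
    A a e z * (∏ j : Fin k, y j ^ (k - 1 - (j : ℕ))) / (∏ j : Fin k, z j ^ (k - 1 - (j : ℕ))) =
      A a' (eP a e) y := by
  -- positivity
  have hJy : 0 < ∏ j : Fin k, y j ^ (k - 1 - (j : ℕ)) :=
    Finset.prod_pos fun j _ => pow_pos (hy j).1 _
  have hJz : 0 < ∏ j : Fin k, z j ^ (k - 1 - (j : ℕ)) :=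
    Finset.prod_pos fun j _ => pow_pos (hz j).1 _
  have hAz := A_pos I A hI hA hz a e
  have hAy := A_pos I A hI hA hy a' (eP a e)
  have hL : 0 < A a e z * (∏ j : Fin k, y j ^ (k - 1 - (j : ℕ))) /
      (∏ j : Fin k, z j ^ (k - 1 - (j : ℕ))) := div_pos (mul_pos hAz hJy) hJz
  apply Real.log_injOn_pos (Set.mem_Ioi.mpr hL) (Set.mem_Ioi.mpr hAy)
  rw [Real.log_div (mul_pos hAz hJy).ne' hJz.ne', Real.log_mul hAz.ne' hJy.ne']
  -- (1) the pieces of `log A a e z`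
  have f1 : ∀ i : Fin k, (a i : ℝ) * Real.log (z i) =
      (a i : ℝ) * Real.log (1 - T (k - i) y) -
        (if (i : ℕ) = 0 then 0 else (a i : ℝ) * Real.log (1 - T (k + 1 - i) y)) := by
    intro i
    rw [log_z T hT hy hz hTz i]
    split_ifs <;> simp [mul_sub]
  have f2 : ∀ i j : Fin k, (if i ≤ j then (e i j : ℝ) * Real.log (1 - I i j z) else 0) =
      (if i ≤ j then (e i j : ℝ) *
          (∑ l : Fin k, if (l : ℕ) < k - j then Real.log (y l) else 0) else 0) +
      (if i ≤ j ∧ (i : ℕ) ≠ 0 then (e i j : ℝ) * Real.log (1 - I (τ j) (τ i) y) else 0) -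
      (if i ≤ j ∧ (i : ℕ) ≠ 0 then (e i j : ℝ) * Real.log (1 - T (k + 1 - i) y) else 0) := by
    intro i j
    by_cases hij : i ≤ j
    · rw [if_pos hij, if_pos hij, ← log_T T hT hy]
      by_cases hi : (i : ℕ) = 0
      · rw [log_one_sub_I_z_zero T I hT hI hTz i j hi hij, if_neg (fun h => h.2 hi),
          if_neg (fun h => h.2 hi)]
        ring
      · rw [log_one_sub_I_z_ne T I τ hT hI hτ1 hy hz hTz i j hi hij, if_pos ⟨hij, hi⟩, if_pos ⟨hij, hi⟩]
        ring
    · rw [if_neg hij, if_neg hij, if_neg (fun h => hij h.1), if_neg (fun h => hij h.1)]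
      ring
  have f3 : ∀ i : Fin k, (if (i : ℕ) = 0 then (0 : ℝ) else Real.log (T i z)) =
      if (i : ℕ) = 0 then 0 else Real.log (1 - T (k + 1 - i) y) := by
    intro i
    split_ifs with hi
    · rfl
    · rw [hTz i (by omega) i.isLt.le]
  -- (2) the pieces of `log A a' e' y`
  have hk : ∀ _j : Fin k, 0 < k := fun j => by have := j.isLt; omega
  have f4 : ∀ i j : Fin k, (if i ≤ j then (eP a e i j : ℝ) * Real.log (1 - I i j y) else 0) =
      (if (i : ℕ) = 0 then (E0 a e j : ℝ) * Real.log (1 - T ((j : ℕ) + 1) y) else 0) +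
      (if i ≤ j ∧ (i : ℕ) ≠ 0 then (E1 e i j : ℝ) * Real.log (1 - I i j y) else 0) := by
    intro i j
    rw [heP]
    by_cases hi : (i : ℕ) = 0
    · have hij : i ≤ j := Fin.le_def.mpr (by rw [hi]; exact Nat.zero_le _)
      rw [if_pos hij, if_pos hi, if_pos hi, if_neg (fun h => h.2 hi), add_zero,
        I_eq_T_of_zero T I hT hI y hi]
    · rw [if_neg hi, if_neg hi, zero_add]
      by_cases hij : i ≤ j
      · rw [if_pos hij, if_pos ⟨hij, hi⟩]
      · rw [if_neg hij, if_neg (fun h => hij h.1)]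
  have f5 : ∀ l : Fin k, (a' l : ℝ) * Real.log (y l) = ((k : ℝ) - 1 - (l : ℕ)) * Real.log (y l) +
      (∑ i : Fin k, ∑ j : Fin k,
        if i ≤ j ∧ (j : ℕ) + (l : ℕ) + 1 ≤ k then (e i j : ℝ) else 0) * Real.log (y l) := by
    intro l
    have : (a' l : ℝ) = ((a' l : ℤ) : ℝ) := by simp
    rw [this, ha' l, hAF]
    push_cast
    ring
  -- (3) expand both sides
  rw [log_A I A hI hA hz, log_A I A hI hA hy, log_prod_pow hy, log_prod_pow' T hT hz]
  simp_rw [f1, f2, f3, f4, f5]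
  simp only [Finset.sum_add_distrib, Finset.sum_sub_distrib]
  -- (4) the three identities
  have S1 := sumId_mono e (fun l => Real.log (y l))
  have S2 := sumId_prefix τ E0 hτ1 hE0 a e (fun m => Real.log (1 - T m y))
  have S3 := sumId_strict τ E1 hτ0 hτ1 hE1 e (fun i j => Real.log (1 - I i j y))
  beta_reduce at S1 S2 S3
  have S4 : (∑ i : Fin k, ∑ j : Fin k, if (i : ℕ) = 0 then
      (E0 a e j : ℝ) * Real.log (1 - T ((j : ℕ) + 1) y) else 0) =
      ∑ j : Fin k, (E0 a e j : ℝ) * Real.log (1 - T ((j : ℕ) + 1) y) := by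
    rw [Finset.sum_comm]
    exact Finset.sum_congr rfl fun j _ => sum_ite_val_zero (hk j) _
  have S5 : (∑ i : Fin k, if (i : ℕ) = 0 then (0 : ℝ) else
      ((a i : ℝ) + 1) * Real.log (1 - T (k + 1 - i) y)) =
      (∑ i : Fin k, if (i : ℕ) = 0 then (0 : ℝ) else (a i : ℝ) * Real.log (1 - T (k + 1 - i) y)) +
      ∑ i : Fin k, if (i : ℕ) = 0 then (0 : ℝ) else Real.log (1 - T (k + 1 - i) y) := by
    rw [← Finset.sum_add_distrib]
    refine Finset.sum_congr rfl fun i _ => ?_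
    split_ifs <;> ring
  rw [S4]
  linarith [S1, S2, S3, S4, S5]

/-! ### Registered sub-goal -/

/-- Registered sub-goal `stub_nonSimpleReductionAux2` (= the monomial-letter sum identity
`sumId_mono`, closed form). -/
theorem stub_nonSimpleReductionAux2 : ∀ (k : ℕ) (e : Fin k → Fin k → ℤ) (Ly : Fin k → ℝ), (∑ i : Fin k, ∑ j : Fin k, if i ≤ j then (e i j : ℝ) * (∑ l : Fin k, if (l : ℕ) < k - j then Ly l else 0) else 0) = ∑ l : Fin k, (∑ i : Fin k, ∑ j : Fin k, if i ≤ j ∧ (j : ℕ) + (l : ℕ) + 1 ≤ k then (e i j : ℝ) else 0) * Ly l :=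
  fun _ e Ly => sumId_mono e Ly

end Summit.KontsevichZagierPeriods.DihedralNormalForm.TorusDescent
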